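import Literature.MathematicalPhysics.QuantumFieldTheory.DimockYuan2024.FieldTranslationNorm
import HarnessLib

/-!
# Dimock, *Ultraviolet stability for QED in d = 3*, Appendix B «Norms» (528)–(536): the single-scale norm `‖E‖_h`
# (529)/(531), the pair norm `‖E‖_{(h₁,h₂)}` (533) and the MULTISCALE norm `‖E‖_{(h₁,…,h_k)}` (536) are, in the monomial
# basis of the Grassmann algebra, ONE norm with a weight per generator — `‖F‖_𝐡 = Σ_S (Π_{ξ∈S} 𝐡(ξ)) |c_S(F)|` — DEFINED,
# with its algebra (the product inequality of paper I LEMMA 19, monotonicity) PROVED and the tree's `hNorm`, `hNorm₂`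
# recovered as instances

statement-level skeleton of published theorems with citation tags; proofs where landed; nothing here is a claim about the Yang–Mills mass gap

**Citation header (reproduction of PUBLISHED work).** J. Dimock, *Ultraviolet stability for QED in d = 3*,
Ann. Henri Poincaré **23** (2022) 2113–2205 (= arXiv:2009.01156v2) [Dimock2022UVStabilityQED3], **Appendix B «Norms»**,
p.73 L25 – p.74 L65 of the held arXiv-v2 text layer `paper:arxiv-2009.01156` (`p.NN Lnn` = PDF page ∕ text-layer line);
J. Dimock, *Quantum electrodynamics on the 3-torus. I*, arXiv:math-ph/0210020 [Dimock2002QED3TorusI], App. B (299) and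
LEMMA 19 p.62 (the tree's `QED3TorusI.hNorm`, `QED3TorusI.hNorm_mul_le`, file `QED3FermionNorm.lean`); J. Dimock–C. Yuan
[DimockYuan2024GNFlow] §2.3 (112) (the tree's `hNorm₂`, file `DimockYuan2024/FieldTranslationNorm.lean`).  Writer seat p11
(literature-prover-lit-balaban-p11-g23-0), YM LIT SWEEP item (c) D8 (row C08; zero weight for the YM-INPRINT tokens).

**The printed text (D8 App. B).** p.73 L25–28: *"B Norms. The effective actions in our renormalization group analysis
will be expressed in terms of polymer functions which are elements of a Grassmann algebra. We define some norms on such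
elements. These can also be combined for mixed versions."*  **B.1 single scale** (p.73 L29–52): *"Consider the unit
lattice, say `T⁰_{N−k}`. Fermi fields `Ψ(x)` are the generators of a Grassmann algebra indexed by `x = (x,β,ω)` … We
consider elements of the Grassmann algebra of the form `E(Ψ) = Σ_{n=0}^∞ (1/n!) Σ_{x_1,…,x_n} E_n(x_1,…,x_n)Ψ(x_1)⋯Ψ(x_n)`
(528) This is actually a finite sum since `T⁰_{N−k}` is finite. A norm with a parameter `h > 0` is defined by
`‖E‖_h = Σ_{n=0}^∞ (hⁿ/n!) Σ_{x_1,…,x_n} |E_n(x_1,…,x_n)|` (529)"*.  **B.2 dressed fields** (p.73 L53 – p.74 L36): on a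
fine lattice with `∫dξ = Σ_{x,β,ω} η³`, `η = L^{−k}`: `E(ψ) = Σ_n (1/n!) ∫ E_n(ξ_1,…,ξ_n)ψ(ξ_1)⋯ψ(ξ_n)dξ` (530),
`‖E_n‖_h = Σ_n (hⁿ/n!) ∫|E_n(ξ_1,…,ξ_n)|dξ` (531); with the Hölder derivative `δ_αψ(ζ)` as *"a separate field"*,
`E(ψ_k, δ_αψ_k) = Σ_{n,m} (1/(n!m!)) ∫ E_{nm}(ξ_1,…,ξ_n,ζ_1,…,ζ_m) ψ(ξ_1)⋯ψ(ξ_n) δ_αψ(ζ_1)⋯δ_αψ(ζ_m)` (532) and *"Norms for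
the kernels are defined for a pair of parameters `h = (h_1,h_2)` by `‖E‖_h = Σ_{n,m} (h_1ⁿh_2^m/(n!m!)) ∫|E_{nm}(ξ_1,…,ξ_n,
ζ_1,…,ζ_m)|dξdζ`"* (533).  **B.3 multiscale** (p.74 L37–65): fields `Ψ_{k,Ω} = (Ψ_{1,δΩ_1}, …, Ψ_{k,δΩ_k})`, `Ψ_{j,δΩ_j}(x)`
with `x ∈ δΩ^{(j)}_j ⊂ T^{−(k−j)}_{N−k}`: `E(Ψ_{k,Ω}) = Σ_{n_1,⋯,n_k} (1/(n_1!⋯n_k!)) ∫ E(x_1,…,x_k) Ψ_{1,δΩ_1}(x_1)⋯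
Ψ_{k,δΩ_k}(x_k) dx_1⋯dx_k` (534)–(535) with `∫dx_i = Σ_{x_i}L^{−3(k−i)}`, and *"The norms on the kernels with a
multiweight `h = (h_1,…,h_k)` are `‖E‖_h = Σ_{n_1,⋯,n_k} (h_1^{n_1}⋯h_k^{n_k}/(n_1!⋯n_k!)) ∫|E(x_1,…,x_k)|dx_1⋯dx_k`"* (536).

**What is formalized.**  As in the tree's rendering of paper I (299) (`QED3FermionNorm.lean`, module docstring: in the
monomial basis `θ_S` of the Grassmann algebra `Λ(ι)` the antisymmetric kernels and the `1/n!` cancel and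
`‖F‖_h = Σ_S h^{#S}|c_S(F)|`), every norm of Appendix B is a sum over the sets `S` of generators of `|c_S(F)|` times a
weight that is a PRODUCT OVER THE LETTERS OF `S`: `h` per letter for (529)/(531) (the volume factors `η³` of `∫dξ` are
absorbed in the coefficient `c_S = η^{3n}E_n(S)` and do not change the formula), `h_1` per `ψ`-letter and `h_2` per
`δ_αψ`-letter for (533), `h_j` per letter of scale `j` for (536).  Hence ONE definition:
* `monoWeight 𝐡 S = Π_{ξ∈S} 𝐡 ξ` and **`hNormW 𝐡 F = Σ_S monoWeight 𝐡 S · ‖c_S(F)‖`** for a weight `𝐡 : ι → ℝ` per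
  generator; **`hNormW_const`**: `𝐡 ≡ h` gives the tree's `hNorm h` ((529)/(531) = paper I (299)); **`hNormW_pairWeight`**: on
  two blocks `ι₁ ⊕ₗ ι₂` with `𝐡 = pairWeight h_1 h_2` (`h_1` on the first, `h_2` on the second), `hNormW` is the tree's
  `hNorm₂ h_1 h_2` ((533);
  [DimockYuan2024GNFlow] (112)); **`multiscaleWeight`** (`𝐡(ξ) = h_{j(ξ)}` for a scale map `j : ι → ℕ`) names (536), with
  `monoWeight_multiscale`: the weight of a monomial is `Π_j h_j^{n_j}`, `n_j` its number of letters of scale `j`.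
  (In the Lean text the weight `𝐡` is written `w`.)
* the norm algebra for `𝐡 ≥ 0`: `hNormW_nonneg`, `hNormW_zero`, `hNormW_grassmannBasis` (`‖θ_S‖_𝐡 = Π_{ξ∈S}𝐡 ξ`),
  `hNormW_one`, `hNormW_gen` (`‖Ψ(ξ)‖_𝐡 = 𝐡 ξ`), `hNormW_smul`, `hNormW_add_le`, `hNormW_sum_le`, **`hNormW_mono`**
  (`𝐡 ≤ 𝐡′` pointwise ⟹ `‖F‖_𝐡 ≤ ‖F‖_{𝐡′}` — the mechanism of D8's repeated *"`‖·‖_{h′} ≤ ‖·‖_h` for `h′ ≤ h`"*),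
  **`hNormW_mul_le`** — `‖FG‖_𝐡 ≤ ‖F‖_𝐡‖G‖_𝐡`, paper I LEMMA 19 with `h^{#S}h^{#T} = h^{#(S⊔T)}` replaced by
  `Π_SΠ_T = Π_{S⊔T}` (the printed mechanism (300)–(301), reusing the tree's `norm_coeff_mul_le`), `hNormW_pow_le`.

**Honest scope.** D8 Appendix B only DEFINES these norms (*"These can also be combined for mixed versions"*); their
algebra is used throughout D8 by reference to the earlier papers of the series and is here the transport of paper I
LEMMA 19 to letter-dependent weights — a property of the definition, not a located statement of D8.  Not here: the
kernel (`E_n`, `ℓ¹`) presentation of (529)–(536) beyond the identification above (for one weight it is the tree's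
`QED3TwoSpeciesKernels`/`hNorm₂_eq_kernels`), the dressed fields `ψ_{k,Ω}(A)` themselves, LEMMA 20-type substitution
bounds with letter-dependent weights.  No `d = 4` statement; nothing about Bałaban's papers.
-/

noncomputable section

namespace Literature.MathematicalPhysics.QuantumFieldTheory.Dimock2011to13

namespace QED3TorusI

open Finset
open Literature.MathematicalPhysics.QuantumLattice
open Literature.MathematicalPhysics.QuantumLattice.GrassmannAlgebra
open Literature.MathematicalPhysics.QuantumFieldTheory.DimockYuan2024.FieldTranslationNorm

variable {𝕜 : Type*} [RCLike 𝕜] {ι : Type*} [LinearOrder ι] [Fintype ι]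

/-! ## §1 The weight of a monomial and the norm `‖F‖_w` -/

/-- the weight `Π_{ξ∈S} w(ξ)` of the monomial `θ_S` — `hⁿ` in (529), `h_1ⁿh_2^m` in (533), `h_1^{n_1}⋯h_k^{n_k}` in (536).
[cite: Dimock2022UVStabilityQED3, App. B (529) p.73 L46–52, (533) p.74 L28–36, (536) p.74 L57–65] -/
def monoWeight (w : ι → ℝ) (S : Finset ι) : ℝ := ∏ ξ ∈ S, w ξ

omit [LinearOrder ι] [Fintype ι] in
/-- `monoWeight w S ≥ 0` for `w ≥ 0`. [cite: Dimock2022UVStabilityQED3, App. B (536) p.74 L57–65] -/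
theorem monoWeight_nonneg {w : ι → ℝ} (hw0 : ∀ ξ, 0 ≤ w ξ) (S : Finset ι) : 0 ≤ monoWeight w S :=
  prod_nonneg fun ξ _ => hw0 ξ

omit [LinearOrder ι] [Fintype ι] in
/-- a constant weight gives `h^{#S}`. [cite: Dimock2022UVStabilityQED3, App. B (529) p.73 L46–52] -/
theorem monoWeight_const (h : ℝ) (S : Finset ι) : monoWeight (fun _ : ι => h) S = h ^ S.card := by
  simp [monoWeight]

omit [LinearOrder ι] [Fintype ι] in
/-- the weight is multiplicative over disjoint unions of letters (`h^{#S}h^{#T} = h^{#(S∪T)}` in paper I LEMMA 19).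
[cite: Dimock2002QED3TorusI, App. B Lemma 19 proof p.62 L23–24] -/
theorem monoWeight_union [DecidableEq ι] (w : ι → ℝ) {S T : Finset ι} (hST : Disjoint S T) :
    monoWeight w (S ∪ T) = monoWeight w S * monoWeight w T := by
  unfold monoWeight
  exact prod_union hST

omit [LinearOrder ι] [Fintype ι] in
/-- monotonicity of the weight in `w` (`0 ≤ w ≤ w′`). [cite: Dimock2022UVStabilityQED3, App. B (536) p.74 L57–65] -/
theorem monoWeight_mono {w w' : ι → ℝ} (h0 : ∀ ξ, 0 ≤ w ξ) (hle : ∀ ξ, w ξ ≤ w' ξ) (S : Finset ι) :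
    monoWeight w S ≤ monoWeight w' S :=
  prod_le_prod (fun ξ _ => h0 ξ) fun ξ _ => hle ξ

/-- **the multiweight norm `‖F‖_w = Σ_S (Π_{ξ∈S}w(ξ)) |c_S(F)|`** — (529)/(531)/(533)/(536) in the monomial basis, with one
weight per generator. [cite: Dimock2022UVStabilityQED3, App. B (529) p.73 L46–52, (533) p.74 L28–36, (536) p.74 L57–65] -/
def hNormW (w : ι → ℝ) (F : GrassmannAlgebra 𝕜 ι) : ℝ := ∑ S : Finset ι, monoWeight w S * ‖coeff F S‖

/-- unfolding. [cite: Dimock2022UVStabilityQED3, App. B (536) p.74 L57–65] -/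
theorem hNormW_def (w : ι → ℝ) (F : GrassmannAlgebra 𝕜 ι) :
    hNormW w F = ∑ S : Finset ι, monoWeight w S * ‖coeff F S‖ := rfl

/-- **(529)/(531) = paper I (299)**: a constant weight `h` gives the tree's `‖F‖_h`.
[cite: Dimock2022UVStabilityQED3, App. B (529) p.73 L46–52; Dimock2002QED3TorusI, App. B (299) p.62 L9–13] -/
theorem hNormW_const (h : ℝ) (F : GrassmannAlgebra 𝕜 ι) : hNormW (fun _ : ι => h) F = hNorm h F := by
  simp only [hNormW, monoWeight_const, hNorm]

/-- **(536)**: the multiscale weight `w(ξ) = h_{j(ξ)}` of a generator of scale `j(ξ)` (*"a multiweight `h = (h_1,…,h_k)`"*).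
[cite: Dimock2022UVStabilityQED3, App. B (534)–(536) p.74 L37–65] -/
def multiscaleWeight (scale : ι → ℕ) (h : ℕ → ℝ) : ι → ℝ := fun ξ => h (scale ξ)

omit [LinearOrder ι] [Fintype ι] in
/-- the multiscale weight of a monomial is `Π_j h_j^{n_j}`, `n_j` = the number of its letters of scale `j`.
[cite: Dimock2022UVStabilityQED3, App. B (536) p.74 L57–65] -/
theorem monoWeight_multiscale [DecidableEq ι] (scale : ι → ℕ) (h : ℕ → ℝ) (S : Finset ι) :
    monoWeight (multiscaleWeight scale h) S = ∏ j ∈ S.image scale, h j ^ (S.filter fun ξ => scale ξ = j).card := by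
  unfold monoWeight multiscaleWeight
  rw [← prod_fiberwise_of_maps_to (g := scale) (t := S.image scale) fun ξ hξ => mem_image_of_mem scale hξ]
  refine prod_congr rfl fun j _ => ?_
  rw [prod_congr rfl fun ξ hξ => by rw [(mem_filter.1 hξ).2], prod_const]

/-! ## §2 The norm algebra (`w ≥ 0`) -/

/-- `‖F‖_w ≥ 0`. [cite: Dimock2022UVStabilityQED3, App. B (536) p.74 L57–65] -/
theorem hNormW_nonneg {w : ι → ℝ} (hw0 : ∀ ξ, 0 ≤ w ξ) (F : GrassmannAlgebra 𝕜 ι) : 0 ≤ hNormW w F :=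
  sum_nonneg fun S _ => mul_nonneg (monoWeight_nonneg hw0 S) (norm_nonneg _)

/-- `‖0‖_w = 0`. [cite: Dimock2022UVStabilityQED3, App. B (536) p.74 L57–65] -/
@[simp] theorem hNormW_zero (w : ι → ℝ) : hNormW w (0 : GrassmannAlgebra 𝕜 ι) = 0 := by
  simp [hNormW, coeff]

/-- `‖θ_S‖_w = Π_{ξ∈S} w ξ`. [cite: Dimock2022UVStabilityQED3, App. B (536) p.74 L57–65] -/
theorem hNormW_grassmannBasis (w : ι → ℝ) (S : Finset ι) :
    hNormW w (grassmannBasis 𝕜 ι S) = monoWeight w S := by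
  simp only [hNormW, coeff, Module.Basis.repr_self]
  rw [sum_eq_single S]
  · simp
  · intro T _ hTS
    simp [hTS.symm]
  · intro hS
    exact absurd (mem_univ S) hS

/-- `‖1‖_w = 1`. [cite: Dimock2022UVStabilityQED3, App. B (528)–(529) p.73 L40–52] -/
theorem hNormW_one (w : ι → ℝ) : hNormW w (1 : GrassmannAlgebra 𝕜 ι) = 1 := by
  have h1 : (1 : GrassmannAlgebra 𝕜 ι) = grassmannBasis 𝕜 ι ∅ := by
    simp [grassmannBasis, Module.Basis.ExteriorAlgebra]
  rw [h1, hNormW_grassmannBasis, monoWeight, prod_empty]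

/-- `‖Ψ(ξ)‖_w = w ξ` for a single generator. [cite: Dimock2022UVStabilityQED3, App. B (529) p.73 L46–52] -/
theorem hNormW_gen (w : ι → ℝ) (ξ : ι) : hNormW w (gen 𝕜 ξ : GrassmannAlgebra 𝕜 ι) = w ξ := by
  rw [← grassmannBasis_singleton, hNormW_grassmannBasis, monoWeight, prod_singleton]

/-- `‖cF‖_w = |c|‖F‖_w`. [cite: Dimock2022UVStabilityQED3, App. B (536) p.74 L57–65] -/
theorem hNormW_smul (w : ι → ℝ) (c : 𝕜) (F : GrassmannAlgebra 𝕜 ι) : hNormW w (c • F) = ‖c‖ * hNormW w F := by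
  simp only [hNormW, coeff, map_smul, Finsupp.smul_apply, smul_eq_mul, norm_mul, mul_sum]
  exact sum_congr rfl fun S _ => by ring

/-- `‖F + G‖_w ≤ ‖F‖_w + ‖G‖_w` (`w ≥ 0`). [cite: Dimock2022UVStabilityQED3, App. B (536) p.74 L57–65] -/
theorem hNormW_add_le {w : ι → ℝ} (hw0 : ∀ ξ, 0 ≤ w ξ) (F G : GrassmannAlgebra 𝕜 ι) :
    hNormW w (F + G) ≤ hNormW w F + hNormW w G := by
  simp only [hNormW, coeff, map_add, Finsupp.add_apply, ← sum_add_distrib, ← mul_add]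
  exact sum_le_sum fun S _ => mul_le_mul_of_nonneg_left (norm_add_le _ _) (monoWeight_nonneg hw0 S)

/-- `‖Σ_i F_i‖_w ≤ Σ_i ‖F_i‖_w` (`w ≥ 0`). [cite: Dimock2022UVStabilityQED3, App. B (536) p.74 L57–65] -/
theorem hNormW_sum_le {w : ι → ℝ} (hw0 : ∀ ξ, 0 ≤ w ξ) {α : Type*} (s : Finset α)
    (F : α → GrassmannAlgebra 𝕜 ι) : hNormW w (∑ i ∈ s, F i) ≤ ∑ i ∈ s, hNormW w (F i) := by
  classical
  induction s using Finset.induction_on with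
  | empty => simp
  | insert a s ha ih =>
    rw [sum_insert ha, sum_insert ha]
    exact (hNormW_add_le hw0 _ _).trans (by linarith)

/-- **monotonicity in the weights**: `0 ≤ w ≤ w′` pointwise ⟹ `‖F‖_w ≤ ‖F‖_{w′}` (so `‖·‖_{h′} ≤ ‖·‖_h` for `h′ ≤ h`, scale
by scale). [cite: Dimock2022UVStabilityQED3, App. B (536) p.74 L57–65] -/
theorem hNormW_mono {w w' : ι → ℝ} (h0 : ∀ ξ, 0 ≤ w ξ) (hle : ∀ ξ, w ξ ≤ w' ξ) (F : GrassmannAlgebra 𝕜 ι) :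
    hNormW w F ≤ hNormW w' F :=
  sum_le_sum fun S _ => mul_le_mul_of_nonneg_right (monoWeight_mono h0 hle S) (norm_nonneg _)

/-- the weight bookkeeping of the product: `Σ_U (Π_U w)·[S ⊔ T = U] ≤ (Π_S w)(Π_T w)` (equality for disjoint `S, T`).
[cite: Dimock2002QED3TorusI, App. B Lemma 19 proof p.62 L23–24] -/
theorem sum_monoWeight_indicator_le {w : ι → ℝ} (hw0 : ∀ ξ, 0 ≤ w ξ) (S T : Finset ι) :
    ∑ U : Finset ι, monoWeight w U * (if Disjoint S T ∧ S ∪ T = U then (1 : ℝ) else 0) ≤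
      monoWeight w S * monoWeight w T := by
  by_cases hd : Disjoint S T
  · rw [sum_eq_single (S ∪ T)]
    · simp [hd, monoWeight_union w hd]
    · intro U _ hU
      simp [Ne.symm hU]
    · intro hU
      exact absurd (mem_univ _) hU
  · simp only [hd, false_and, if_false, mul_zero, sum_const_zero]
    exact mul_nonneg (monoWeight_nonneg hw0 S) (monoWeight_nonneg hw0 T)

/-- **the product inequality `‖FG‖_w ≤ ‖F‖_w‖G‖_w`** (`w ≥ 0`) — paper I LEMMA 19 with letter-dependent weights, by its
printed mechanism (300)–(301) (the tree's `norm_coeff_mul_le`) and `Π_SΠ_T = Π_{S⊔T}`.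
[cite: Dimock2002QED3TorusI, App. B Lemma 19 p.62 L14–24; Dimock2022UVStabilityQED3, App. B (536) p.74 L57–65] -/
theorem hNormW_mul_le {w : ι → ℝ} (hw0 : ∀ ξ, 0 ≤ w ξ) (F G : GrassmannAlgebra 𝕜 ι) :
    hNormW w (F * G) ≤ hNormW w F * hNormW w G := by
  calc hNormW w (F * G)
      = ∑ U, monoWeight w U * ‖coeff (F * G) U‖ := rfl
    _ ≤ ∑ U, monoWeight w U *
          ∑ S, ∑ T, ‖coeff F S‖ * ‖coeff G T‖ * (if Disjoint S T ∧ S ∪ T = U then 1 else 0) :=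
        sum_le_sum fun U _ => mul_le_mul_of_nonneg_left (norm_coeff_mul_le F G U) (monoWeight_nonneg hw0 U)
    _ = ∑ S, ∑ T, ‖coeff F S‖ * ‖coeff G T‖ *
          ∑ U, monoWeight w U * (if Disjoint S T ∧ S ∪ T = U then (1 : ℝ) else 0) := by
        simp only [mul_sum]
        rw [sum_comm]
        refine sum_congr rfl fun S _ => ?_
        rw [sum_comm]
        refine sum_congr rfl fun T _ => ?_
        refine sum_congr rfl fun U _ => ?_
        ring
    _ ≤ ∑ S, ∑ T, ‖coeff F S‖ * ‖coeff G T‖ * (monoWeight w S * monoWeight w T) :=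
        sum_le_sum fun S _ => sum_le_sum fun T _ =>
          mul_le_mul_of_nonneg_left (sum_monoWeight_indicator_le hw0 S T)
            (mul_nonneg (norm_nonneg _) (norm_nonneg _))
    _ = hNormW w F * hNormW w G := by
        rw [hNormW, hNormW, sum_mul_sum]
        refine sum_congr rfl fun S _ => sum_congr rfl fun T _ => ?_
        ring

/-- `‖Fⁿ‖_w ≤ ‖F‖_wⁿ` (`w ≥ 0`). [cite: Dimock2002QED3TorusI, App. B Lemma 19 p.62 L14] -/
theorem hNormW_pow_le {w : ι → ℝ} (hw0 : ∀ ξ, 0 ≤ w ξ) (F : GrassmannAlgebra 𝕜 ι) (n : ℕ) :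
    hNormW w (F ^ n) ≤ hNormW w F ^ n := by
  induction n with
  | zero => simp [hNormW_one]
  | succ n ih =>
    rw [pow_succ, pow_succ]
    exact (hNormW_mul_le hw0 _ _).trans (mul_le_mul_of_nonneg_right ih (hNormW_nonneg hw0 F))

/-! ## §3 Two blocks: the pair norm (533) = the tree's `hNorm₂` -/

section TwoBlocks

variable {ι₁ ι₂ : Type*} [LinearOrder ι₁] [Fintype ι₁] [LinearOrder ι₂] [Fintype ι₂]

/-- the pair weight `(h_1, h_2)` of (533): `h_1` on the letters of the first block, `h_2` on the second.
[cite: Dimock2022UVStabilityQED3, App. B (532)–(533) p.74 L12–36] -/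
def pairWeight (h₁ h₂ : ℝ) : ι₁ ⊕ₗ ι₂ → ℝ := fun w => Sum.elim (fun _ => h₁) (fun _ => h₂) (ofLex w)

/-- the pair weight of a two-block monomial is `h_1^{#S₁}h_2^{#S₂}`. [cite: Dimock2022UVStabilityQED3, App. B (533) p.74 L28–36] -/
theorem monoWeight_pairWeight (h₁ h₂ : ℝ) (S : Finset (ι₁ ⊕ₗ ι₂)) :
    monoWeight (pairWeight h₁ h₂) S = h₁ ^ (fstPart S).card * h₂ ^ (sndPart S).card := by
  classical
  unfold monoWeight
  conv_lhs => rw [← map_fstPart_union_map_sndPart S]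
  have hd : Disjoint ((fstPart S).map (inlEmb : ι₁ ↪o ι₁ ⊕ₗ ι₂).toEmbedding)
      ((sndPart S).map (inrEmb : ι₂ ↪o ι₁ ⊕ₗ ι₂).toEmbedding) := by
    rw [disjoint_left]
    intro w hw1 hw2
    obtain ⟨a, _, rfl⟩ := mem_map.1 hw1
    obtain ⟨b, _, hb⟩ := mem_map.1 hw2
    have : (inrEmb : ι₂ ↪o ι₁ ⊕ₗ ι₂) b = (inlEmb : ι₁ ↪o ι₁ ⊕ₗ ι₂) a := hb
    simp [inlEmb, inrEmb] at this
  rw [prod_union hd, prod_map, prod_map]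
  simp [pairWeight, inlEmb, inrEmb]

/-- **(533) = the tree's two-parameter norm**: `hNormW (pairWeight h_1 h_2) = hNorm₂ h_1 h_2`
([DimockYuan2024GNFlow] (112), file `DimockYuan2024/FieldTranslationNorm.lean`).
[cite: Dimock2022UVStabilityQED3, App. B (533) p.74 L28–36; DimockYuan2024GNFlow, §2.3 (112) p.18 L28–33] -/
theorem hNormW_pairWeight (h₁ h₂ : ℝ) (F : GrassmannAlgebra 𝕜 (ι₁ ⊕ₗ ι₂)) :
    hNormW (pairWeight h₁ h₂) F = hNorm₂ h₁ h₂ F := by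
  unfold hNormW hNorm₂
  refine sum_congr rfl fun S _ => ?_
  rw [monoWeight_pairWeight]

end TwoBlocks

end QED3TorusI

end Literature.MathematicalPhysics.QuantumFieldTheory.Dimock2011to13
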